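import Summits.Ventures.LatticeQCDFlow.Scaling.ExchangeSchemeCutMixingFloor
import Summits.Ventures.LatticeQCDFlow.Scaling.ReplicaExchangeFlowSwapTransport
import Summits.Ventures.LatticeQCDFlow.Scaling.FlowSwapAcceptanceTwoSided

/-!
HONEST FRAMING: exact (Metropolis-corrected) sampling algorithms for lattice gauge theory; figures
of merit are autocorrelation/cost numbers at stated couplings and volumes; no continuum-physics
claim.

# FlowSwapCutMixingFloor — THE WEAKEST LINK WITH LEARNED MAPS: FOR MAP-ASSISTED SWAPS WITH SECTOR-PRESERVING BIJECTIONS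
# THE STATIONARY RATE AT WHICH A SECTOR LABEL CROSSES THE CUT `j` IS AT MOST `Acc_j(φ)/K`, `Acc_j(φ) =
# Σ_{u,w} min{μ_j(u)μ_{j+1}(w), μ_j(φ_j⁻¹w)μ_{j+1}(φ_j u)} ≤ 1 − ½Σ_u|μ_j(u) − μ_{j+1}(φ_j u)|` THE MAP-ASSISTED ACCEPTANCE,
# SO `d(n) ≤ ¼ ⇒ π̃(T) ≤ 4n·t·Acc_j(φ)/K` FOR EVERY COUNT EVENT BELOW THE CUT AND `K ≤ 4n·t` — A MAP WHOSE PUSH-FORWARD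
# MISSES THE NEXT COUPLING THROTTLES EVERY REPLICA BELOW IT (lean-2 GEN-20, ours)

Venture-side (OURS).  Cell `lqcd-flow` (pub-lqcd), unit `pub-lqcd-lean-2-g20`, 2026-08-25.  The map-assisted instance of
`ExchangeSchemeCutMixingFloor` (§2 there is for ANY stationary exchange move; §3 there is the bare Metropolis ladder):
`Q = ptFlowSwap μ φ` of `ReplicaExchangeFlowSwap` (propose the flow swap `flowSwapAt φ i x` of a uniform adjacent pair,
Metropolis-correct against `π̃ = ⊗μ_k`), with bijections preserving the sector `A` (`φ_i u ∈ A ↔ u ∈ A`), the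
sampler `P = ptFlowSampler t μ M φ = t·Q + (1−t)·prodKernel (1/(K+1)) M`, replicas below the cut `j` sector-frozen.

* §1 `sectorCountBelow_flowSwapAt` — a sector-preserving flow swap away from the cut keeps `N_j`;
  (`ReplicaExchangeFlowSwapTransport.tensorFun_flowSwapAt_mul`, reused); **`flowSwap_acceptance_eq_twoLevel`** — `Σ_x min{π̃(x), π̃(x^{φ,j})} = Acc_j(φ)` (a two-level quantity, the object of
  `FlowSwapAcceptanceTwoSided`).
* §2 `ptFlowSwap_change_le_pointwise` (`≤ 1/K`), **`ptFlowSwap_changeRate_le`** (`r_j ≤ Acc_j(φ)/K`);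
  **`ptFlowCut_mixing_floor`** — `d(n) ≤ ¼ ⇒ π̃(T) ≤ 4n·t·Acc_j(φ)/K`; **`ptFlowCut_mixing_floor_tv`** —
  `π̃(T) ≤ 4n·t·(1 − ½Σ_u|μ_j(u) − μ_{j+1}(φ_j u)|)/K`; **`ptFlowCut_mixing_floor_ballistic`** — `K ≤ 4n·t`.

Reading (no numerics implied): a trained map between two adjacent couplings buys acceptance, and acceptance is what the
per-cut floor charges: if the push-forward of level `j` by `φ_j` is at total-variation distance `δ` from level `j+1`, no
schedule whatsoever lets the replicas below equilibrate before `K·π̃(T)/(4t(1−δ))` steps; and even perfect transports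
(`Acc = 1`) leave the order-`K` floor.  NOT CLAIMED: floors matching these; maps that change sectors (they are direct
tunnelling and enter `SectorCountMixingFloor`'s drift instead); continuous configuration spaces; anything measured.
Literature grade (cell rule): corollary file of `ExchangeSchemeCutMixingFloor` (KNOWN MECHANISM, NEW TYPING); nothing
cited as a fact; no new bib keys.
-/

noncomputable section

open Finset Function
open Literature.Probability.MarkovChains

namespace Summit.Ventures.LatticeQCDFlow.Scaling

variable {S : Type*} [Fintype S] [DecidableEq S] {K : ℕ} {μ : Fin (K + 1) → S → ℝ}
  {M : Fin (K + 1) → S → S → ℝ} {t : ℝ} {φ : Fin K → Equiv.Perm S} {A : Finset S} {j : Fin K}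

/-! ## §1 Flow swaps and the count below a cut -/

omit [Fintype S] in
/-- **A sector-preserving flow swap away from the cut keeps `N_j`** (and so does the one at the cut when the two labels
agree, not needed here). [ours] -/
theorem sectorCountBelow_flowSwapAt (hφ : ∀ i u, (φ i u ∈ A ↔ u ∈ A)) {i : Fin K} (hij : i ≠ j)
    (x : Fin (K + 1) → S) : sectorCountBelow A j (flowSwapAt φ i x) = sectorCountBelow A j x := by
  have hne : i.castSucc ≠ i.succ := ne_of_lt Fin.castSucc_lt_succ
  have hij' : (i : ℕ) ≠ j := fun e => hij (Fin.ext e)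
  have hsymm : ∀ u, ((φ i).symm u ∈ A ↔ u ∈ A) := fun u => by
    have := hφ i ((φ i).symm u); rw [Equiv.apply_symm_apply] at this; exact this.symm
  unfold flowSwapAt
  rw [sectorCountBelow_update, sectorCountBelow_update, update_of_ne hne.symm]
  have e1 : (if (φ i) (x i.castSucc) ∈ A then (1 : ℝ) else 0) = (if x i.castSucc ∈ A then (1 : ℝ) else 0) := by
    rw [if_congr (hφ i _) rfl rfl]
  have e2 : (if (φ i).symm (x i.succ) ∈ A then (1 : ℝ) else 0) = (if x i.succ ∈ A then (1 : ℝ) else 0) := by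
    rw [if_congr (hsymm _) rfl rfl]
  rw [e1, e2]
  have hiff : ((j : ℕ) < ((i.castSucc : Fin (K + 1)) : ℕ)) ↔ ((j : ℕ) < ((i.succ : Fin (K + 1)) : ℕ)) := by
    rw [Fin.val_castSucc, Fin.val_succ]; omega
  by_cases h : (j : ℕ) < ((i.succ : Fin (K + 1)) : ℕ)
  · rw [if_pos h, if_pos (hiff.mpr h)]; ring
  · rw [if_neg h, if_neg (fun h' => h (hiff.mp h'))]; ring

/-- **The stationary acceptance of the map-assisted swap at the pair `(j, j+1)` is a two-level quantity:**
`Σ_x min{π̃(x), π̃(x^{φ,j})} = Σ_{u,w} min{μ_j(u)μ_{j+1}(w), μ_j(φ_j⁻¹w)μ_{j+1}(φ_j u)}`. [ours] -/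
theorem flowSwap_acceptance_eq_twoLevel (hμ : ∀ k x, 0 < μ k x) (hμ1 : ∀ k, ∑ u, μ k u = 1) (φ : Fin K → Equiv.Perm S)
    (j : Fin K) :
    ∑ x : Fin (K + 1) → S, min (tensorFun μ x) (tensorFun μ (flowSwapAt φ j x))
      = ∑ u, ∑ w, min (μ j.castSucc u * μ j.succ w) (μ j.castSucc ((φ j).symm w) * μ j.succ (φ j u)) := by
  have hne : j.castSucc ≠ j.succ := ne_of_lt Fin.castSucc_lt_succ
  -- `min{π̃(x), π̃(x^φ)} = π̃(x)·g(x_j, x_{j+1})` with `g(u,w) = min{μ_j(u)μ_{j+1}(w), μ_j(φ⁻¹w)μ_{j+1}(φu)}/(μ_j(u)μ_{j+1}(w))`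
  set g : S → S → ℝ := fun u w =>
    min (μ j.castSucc u * μ j.succ w) (μ j.castSucc ((φ j).symm w) * μ j.succ (φ j u)) / (μ j.castSucc u * μ j.succ w)
    with hg
  have hpt : ∀ x : Fin (K + 1) → S, min (tensorFun μ x) (tensorFun μ (flowSwapAt φ j x))
      = tensorFun μ x * g (x j.castSucc) (x j.succ) := by
    intro x
    have hd : 0 < μ j.castSucc (x j.castSucc) * μ j.succ (x j.succ) := mul_pos (hμ _ _) (hμ _ _)
    have hπ : 0 ≤ tensorFun μ x := (tensorFun_pos hμ x).le
    have e : tensorFun μ (flowSwapAt φ j x) = tensorFun μ x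
        * ((μ j.castSucc ((φ j).symm (x j.succ)) * μ j.succ (φ j (x j.castSucc)))
          / (μ j.castSucc (x j.castSucc) * μ j.succ (x j.succ))) := by
      rw [← mul_div_assoc, eq_div_iff hd.ne', tensorFun_flowSwapAt_mul μ φ x j]
    rw [hg]; simp only
    rw [e, ← min_div_div_right hd.le, div_self hd.ne', mul_min_of_nonneg _ _ hπ, mul_one]
  simp_rw [hpt]
  rw [sum_tensorFun_mul_two_fun hμ1 hne g]
  refine sum_congr rfl fun u _ => sum_congr rfl fun w _ => ?_
  rw [hg]; simp only
  rw [mul_div_cancel₀ _ (mul_pos (hμ _ u) (hμ _ w)).ne']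

/-! ## §2 The per-cut mixing floor for map-assisted swaps -/

section Flow

/-- From every state the flow-swap move changes `N_j` with probability at most `1/K` (sector-preserving maps). [ours] -/
theorem ptFlowSwap_change_le_pointwise (μ : Fin (K + 1) → S → ℝ) (hφ : ∀ i u, (φ i u ∈ A ↔ u ∈ A))
    (x : Fin (K + 1) → S) :
    ∑ y ∈ univ.filter (fun y => sectorCountBelow A j y ≠ sectorCountBelow A j x), ptFlowSwap μ φ x y ≤ 1 / K := by
  have hKpos : (0 : ℝ) < K := Nat.cast_pos.mpr (Fin.pos j)
  have h1 : ∀ y ∈ univ.filter (fun y => sectorCountBelow A j y ≠ sectorCountBelow A j x),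
      ptFlowSwap μ φ x y ≤ ∑ i : Fin K, (if y = flowSwapAt φ i x then (1 : ℝ) / K else 0) := by
    intro y hy
    have hyx : y ≠ x := fun e => (mem_filter.mp hy).2 (by rw [e])
    unfold ptFlowSwap
    rw [mhKernel_of_ne hyx]
    exact mhRate_le _ _ _ _
  refine (sum_le_sum h1).trans ?_
  rw [sum_comm]
  have h2 : ∀ i : Fin K, ∑ y ∈ univ.filter (fun y => sectorCountBelow A j y ≠ sectorCountBelow A j x),
      (if y = flowSwapAt φ i x then (1 : ℝ) / K else 0) = if i = j then
        (if sectorCountBelow A j (flowSwapAt φ j x) ≠ sectorCountBelow A j x then (1 : ℝ) / K else 0) else 0 := by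
    intro i
    rw [Finset.sum_ite_eq' (univ.filter (fun y => sectorCountBelow A j y ≠ sectorCountBelow A j x)) (flowSwapAt φ i x)
      (fun _ => (1 : ℝ) / K)]
    by_cases hi : i = j
    · subst hi; simp only [mem_filter, mem_univ, true_and, if_true]
    · rw [if_neg hi, if_neg]
      rw [mem_filter, sectorCountBelow_flowSwapAt hφ hi]
      exact fun h => h.2 rfl
  rw [sum_congr rfl fun i _ => h2 i, Finset.sum_ite_eq' univ j, if_pos (mem_univ _)]
  split_ifs
  · exact le_rfl
  · positivity

variable (hμ : ∀ k x, 0 < μ k x) (hφ : ∀ i u, (φ i u ∈ A ↔ u ∈ A))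
include hμ hφ

/-- **`r_j ≤ Acc_j(φ)/K`:** in stationarity the flow-swap move changes `N_j` at rate at most the map-assisted acceptance of
the pair `(j, j+1)` divided by `K`. [ours] -/
theorem ptFlowSwap_changeRate_le :
    ∑ x, tensorFun μ x * ∑ y ∈ univ.filter (fun y => sectorCountBelow A j y ≠ sectorCountBelow A j x), ptFlowSwap μ φ x y
      ≤ (∑ x : Fin (K + 1) → S, min (tensorFun μ x) (tensorFun μ (flowSwapAt φ j x))) / K := by
  have hKpos : (0 : ℝ) < K := Nat.cast_pos.mpr (Fin.pos j)
  rw [Finset.sum_div]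
  refine sum_le_sum fun x _ => ?_
  rw [mul_sum]
  have h1 : ∀ y ∈ univ.filter (fun y => sectorCountBelow A j y ≠ sectorCountBelow A j x),
      tensorFun μ x * ptFlowSwap μ φ x y
        = ∑ i : Fin K, (if y = flowSwapAt φ i x then (1 : ℝ) / K * min (tensorFun μ x) (tensorFun μ y) else 0) := by
    intro y hy
    have hyx : y ≠ x := fun e => (mem_filter.mp hy).2 (by rw [e])
    rw [tensorFun_mul_ptFlowSwap hμ hyx]
    unfold ptFlowProposal
    rw [sum_mul]
    exact sum_congr rfl fun i _ => by split_ifs <;> simp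
  rw [sum_congr rfl h1, sum_comm]
  have h2 : ∀ i : Fin K, ∑ y ∈ univ.filter (fun y => sectorCountBelow A j y ≠ sectorCountBelow A j x),
      (if y = flowSwapAt φ i x then (1 : ℝ) / K * min (tensorFun μ x) (tensorFun μ y) else 0) = if i = j then
        (if sectorCountBelow A j (flowSwapAt φ j x) ≠ sectorCountBelow A j x
          then (1 : ℝ) / K * min (tensorFun μ x) (tensorFun μ (flowSwapAt φ j x)) else 0) else 0 := by
    intro i
    rw [Finset.sum_ite_eq' (univ.filter (fun y => sectorCountBelow A j y ≠ sectorCountBelow A j x)) (flowSwapAt φ i x)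
      (fun y => (1 : ℝ) / K * min (tensorFun μ x) (tensorFun μ y))]
    by_cases hi : i = j
    · subst hi; simp only [mem_filter, mem_univ, true_and, if_true]
    · rw [if_neg hi, if_neg]
      rw [mem_filter, sectorCountBelow_flowSwapAt hφ hi]
      exact fun h => h.2 rfl
  rw [sum_congr rfl fun i _ => h2 i, Finset.sum_ite_eq' univ j, if_pos (mem_univ _)]
  have hmin : 0 ≤ min (tensorFun μ x) (tensorFun μ (flowSwapAt φ j x)) :=
    le_min (tensorFun_pos hμ _).le (tensorFun_pos hμ _).le
  split_ifs
  · exact le_of_eq (by ring)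
  · positivity

variable (hμ1 : ∀ k, ∑ u, μ k u = 1) (hM : ∀ k, IsRowStochastic (M k)) (hMrev : ∀ k, DetailedBalance (μ k) (M k))
  (ht0 : 0 ≤ t) (ht1 : t ≤ 1) (hfrozen : ∀ k : Fin (K + 1), (j : ℕ) < k → ∀ u v, M k u v ≠ 0 → (u ∈ A ↔ v ∈ A))
  {T : Finset (Fin (K + 1) → S)} (hT : ∀ x ∈ T, ∀ y, y ∉ T → sectorCountBelow A j y ≠ sectorCountBelow A j x)
  (hT0 : 0 < ∑ x ∈ T, tensorFun μ x) (hT1 : ∑ x ∈ T, tensorFun μ x ≤ 1 / 2)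
include hμ1 hM hMrev ht0 ht1 hfrozen hT hT0 hT1

/-- **MAP-ASSISTED SWAPS: `d(n) ≤ ¼ ⇒ π̃(T) ≤ 4n·t·Acc_j(φ)/K`** — `t_mix ≥ K·π̃(T)/(4t·Acc_j(φ))` for every count event
below a cut above sector-frozen replicas, the acceptance in its two-level form. [ours] -/
theorem ptFlowCut_mixing_floor {n : ℕ} (hn : worstTvDist (ptFlowSampler t μ M φ) (tensorFun μ) n ≤ 1 / 4) :
    ∑ x ∈ T, tensorFun μ x ≤ 4 * n * (t * ((∑ u, ∑ w, min (μ j.castSucc u * μ j.succ w)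
      (μ j.castSucc ((φ j).symm w) * μ j.succ (φ j u))) / K)) := by
  have hw0 : ∀ _k : Fin (K + 1), (0 : ℝ) ≤ 1 / (K + 1) := fun _ => by positivity
  have h := exchangeCut_mixing_floor hμ hμ1 hM hMrev hw0 (sum_uniform_weight K) ht0 ht1 (ptFlowSwap_isRowStochastic hμ)
    ((ptFlowSwap_detailedBalance hμ).isStationary (ptFlowSwap_isRowStochastic hμ).2) hfrozen hT hT0 hT1
    (n := n) (by rwa [show ptFlowSampler t μ M φ = fun x y => t * ptFlowSwap μ φ x y
      + (1 - t) * prodKernel (fun _ : Fin (K + 1) => (1 : ℝ) / (K + 1)) M x y from rfl] at hn)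
  rw [← flowSwap_acceptance_eq_twoLevel hμ hμ1 φ j]
  exact h.trans (mul_le_mul_of_nonneg_left (mul_le_mul_of_nonneg_left (ptFlowSwap_changeRate_le hμ hφ) ht0)
    (by positivity))

/-- **THE TRANSPORT DEFECT VERSION: `π̃(T) ≤ 4n·t·(1 − ½Σ_u|μ_j(u) − μ_{j+1}(φ_j u)|)/K`** — a map whose push-forward of
level `j` misses level `j+1` by total variation `δ` floors the mixing time at `K·π̃(T)/(4t(1−δ))`. [ours] -/
theorem ptFlowCut_mixing_floor_tv {n : ℕ} (hn : worstTvDist (ptFlowSampler t μ M φ) (tensorFun μ) n ≤ 1 / 4) :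
    ∑ x ∈ T, tensorFun μ x
      ≤ 4 * n * (t * ((1 - (1 / 2) * ∑ u, |μ j.castSucc u - μ j.succ (φ j u)|) / K)) := by
  have hKpos : (0 : ℝ) < K := Nat.cast_pos.mpr (Fin.pos j)
  refine (ptFlowCut_mixing_floor hμ hφ hμ1 hM hMrev ht0 ht1 hfrozen hT hT0 hT1 hn).trans ?_
  have hle := flowPair_acceptance_le_one_sub_tv (hμ1 j.castSucc) (hμ1 j.succ) (φ j)
  exact mul_le_mul_of_nonneg_left (mul_le_mul_of_nonneg_left (div_le_div_of_nonneg_right hle hKpos.le) ht0)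
    (by positivity)

/-- **`d(n) ≤ ¼ ⇒ K ≤ 4n·t`** for the map-assisted ladder too. [ours] -/
theorem ptFlowCut_mixing_floor_ballistic {n : ℕ} (hn : worstTvDist (ptFlowSampler t μ M φ) (tensorFun μ) n ≤ 1 / 4) :
    (K : ℝ) ≤ 4 * n * t := by
  have hKpos : (0 : ℝ) < K := Nat.cast_pos.mpr (Fin.pos j)
  have hw0 : ∀ _k : Fin (K + 1), (0 : ℝ) ≤ 1 / (K + 1) := fun _ => by positivity
  have h := exchangeCut_mixing_floor_pointwise hμ hμ1 hM hMrev hw0 (sum_uniform_weight K) ht0 ht1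
    (ptFlowSwap_isRowStochastic hμ) ((ptFlowSwap_detailedBalance hμ).isStationary (ptFlowSwap_isRowStochastic hμ).2)
    hfrozen hT hT0 hT1 (c := 1 / K) (fun x _ => ptFlowSwap_change_le_pointwise μ hφ x) (n := n)
    (by rwa [show ptFlowSampler t μ M φ = fun x y => t * ptFlowSwap μ φ x y
      + (1 - t) * prodKernel (fun _ : Fin (K + 1) => (1 : ℝ) / (K + 1)) M x y from rfl] at hn)
  rw [← mul_assoc, mul_one_div, le_div_iff₀ hKpos, one_mul] at h
  exact h

end Flow

end Summit.Ventures.LatticeQCDFlow.Scaling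

end
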